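import Literature.AlgebraicGeometry.Frobenioids.MotivatingExamplesSub
import Mathlib.RingTheory.AdjoinRoot
import Mathlib.Algebra.Polynomial.SpecificDegree
import Mathlib.RingTheory.Polynomial.RationalRoot
import Mathlib.Analysis.SpecialFunctions.Pow.Real
import Mathlib.NumberTheory.NumberField.InfinitePlace.Basic
import HarnessLib

/-!
# Frobenioids I, Example 6.3: the typed statement `Ex63_isFrobenioid F K` needs `K/F` Galois —
# kernel refutation of its universal closure at `ℚ ⊂ ℚ(∛2)` (PROOF-ONLY companion)

Mochizuki, *The geometry of Frobenioids I: the general theory*, Kyushu J. Math. **62** (2008), Example 6.3,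
kurims text p. 113: "Thus, if `F̃` is a [not necessarily finite] **Galois** extension of `F`, `G = Gal(F̃/F)`,
`D = B(G)⁰`, then `Φ`, `B` determine monoids on `D` … Thus, by Theorem 5.2, (ii), this data determines a
[model] Frobenioid `C_{F̃/F}`" [cite: MochizukiFrdI2008, Ex. 6.3 p.113]; Definition 1.1 (ii) p. 19 (a *monoid on
`D`*: every FSM-morphism of `D` pulls back to an ISOMORPHISM of monoids); §0 p. 14 (FSM-morphisms).

The tree's named fact `Literature.AlgebraicGeometry.Frobenioids.Ex63_isFrobenioid F K`
(`MotivatingExamplesSub.lean`, FACT-LIST row F-1130) binds `(F) [Field F] [NumberField F] (K) [Field K]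
[Algebra F K]` and does NOT carry print's hypothesis that `K/F` is Galois; its kernel witness of record,
abc-iut-L6-t10's `Ex63_isFrobenioid_holds` (re-exported with the fully qualified closed type as
`Ex63_isFrobenioid_holds'` in `FactListWitnessesFrd.lean`), assumes `[IsGalois F K]`.  This PROOF-ONLY file
shows that the hypothesis cannot be dropped, i.e. that the universal closure of the row over the decl's own
binders is FALSE:

* `Ex63NonGalois.isFSM_toBot_of_subsingleton_algEnd`, `…not_isOfFSMType_of_subsingleton_algEnd`,
  `…not_isMonoidOn_of_subsingleton_algEnd` — for a number field `F`, a finite extension `K/F`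
  whose only `F`-algebra endomorphism is the identity, with `Spec F` having one archimedean place and `Spec K`
  at least two, the arrow `Spec K → Spec F` of `D = FinSubextCat F K` is an FSM-morphism along which the
  arithmetic divisor monoid `Φ` (`arithDivisorFunctor F K`) does NOT pull back surjectively (archimedean
  coordinates are copied along `InfinitePlace.comap`), so `Φ` is not a monoid on `D` (Def. 1.1 (ii));
* `Ex63NonGalois.not_ex63_isFrobenioid_of_subsingleton_algEnd` — hence the model functor is not even a
  pre-Frobenioid, and `¬ Ex63_isFrobenioid F K`;
* `Ex63NonGalois.not_ex63_isFrobenioid_rat` — over `F = ℚ`: every `K` of degree `≥ 3` with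
  `Subsingleton (K →ₐ[ℚ] K)` is a counterexample;
* `Ex63NonGalois.not_ex63_isFrobenioid_cubicField` — `K = ℚ(∛2) := AdjoinRoot (X ^ 3 - C 2)` is such a field
  (private helpers: irreducibility by the rational root theorem; rigidity `End_ℚ(K) = {id}` through the real
  embedding and injectivity of `x ↦ x³` on `ℝ`; two archimedean places from `r₁ + 2 r₂ = 3`);
* `not_forall_ex63_isFrobenioid` — the kernel `¬ ∀ F K, Ex63_isFrobenioid F K`.

FACT-LIST reading (abc-iut cell, R5/R7): row F-1130 = «universal-closure REFUTED (binder hygiene: the decl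
omits print's Galois hypothesis); instance form under `[IsGalois F K]` PROVED (`Ex63_isFrobenioid_holds'`)».
Refuted-as-typed is a statement about OUR typing, not about the paper, whose `F̃/F` is Galois throughout.
No definitions of the tree are touched; nothing here bears on [IUTchIII] Cor. 3.12 or asserts anything about abc.
-/

noncomputable section

namespace Literature.AlgebraicGeometry.Frobenioids

open CategoryTheory Opposite NumberField Polynomial IntermediateField

namespace Ex63NonGalois

/-! ### A. A general obstruction: a rigid finite extension with a split archimedean place -/

section General

variable {F : Type} [Field F] [NumberField F] {K : Type} [Field K] [Algebra F K] [FiniteDimensional F K]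

omit [NumberField F] [FiniteDimensional F K] in
/-- `F`-algebra maps out of the bottom intermediate field `F ⊆ K` are unique. [folklore] -/
private theorem algHom_bot_eq {A : Type*} [Semiring A] [Algebra F A]
    (φ ψ : (⊥ : IntermediateField F K) →ₐ[F] A) : φ = ψ := by
  have h : φ.comp ((botEquiv F K).symm : F →ₐ[F] (⊥ : IntermediateField F K)) =
      ψ.comp ((botEquiv F K).symm : F →ₐ[F] (⊥ : IntermediateField F K)) :=
    Subsingleton.elim _ _
  refine AlgHom.ext fun x => ?_
  have hx := congrArg (fun f : F →ₐ[F] A => f (botEquiv F K x)) h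
  simpa using hx

omit [NumberField F] [FiniteDimensional F K] in
/-- If the identity is the only `F`-algebra endomorphism of `K`, then `F`-algebra maps out of the top
intermediate field `K ⊆ K` into any intermediate field are unique. [folklore] -/
private theorem algHom_top_eq (hEnd : ∀ φ ψ : K →ₐ[F] K, φ = ψ) (E : IntermediateField F K)
    (φ ψ : (⊤ : IntermediateField F K) →ₐ[F] E) : φ = ψ := by
  have h := hEnd (E.val.comp (φ.comp (topEquiv (F := F) (E := K)).symm.toAlgHom))
    (E.val.comp (ψ.comp (topEquiv (F := F) (E := K)).symm.toAlgHom))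
  refine AlgHom.ext fun x => ?_
  have hx := congrArg (fun f : K →ₐ[F] K => f (topEquiv (F := F) (E := K) x)) h
  simp only [AlgHom.coe_comp, Function.comp_apply, IntermediateField.coe_val] at hx
  exact Subtype.ext hx

omit [NumberField F] in
/-- Under rigidity of `K/F`, the structure arrow `Spec K → Spec F` of `D = FinSubextCat F K` (there is exactly
one) is an **FSM-morphism** (§0 p. 14): fiberwise surjective (every `Spec L → Spec F` is dominated by `Spec K`)
and a monomorphism (two arrows into `Spec K` are maps `K → L` over `F`, which coincide).
[cite: MochizukiFrdI2008, §0 p.14] -/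
theorem isFSM_toBot_of_subsingleton_algEnd (hEnd : ∀ φ ψ : K →ₐ[F] K, φ = ψ)
    (β : (⟨⊤⟩ : FinSubextCat F K) ⟶ ⟨⊥⟩) : IsFSM β := by
  refine ⟨fun X γ => ⟨⟨⊤⟩, 𝟙 _, ⟨IntermediateField.inclusion le_top⟩, ?_⟩, ⟨fun g h _ => ?_⟩⟩
  · exact FinSubextCat.hom_ext (algHom_bot_eq _ _)
  · exact FinSubextCat.hom_ext (algHom_top_eq hEnd _ _ _)

omit [NumberField F] in
/-- The structure arrow `Spec K → Spec F` of `D` is not an isomorphism as soon as `K ≠ F` (so, under rigidity, a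
monomorphism of `D` that is not an isomorphism — contrast [FrdI] proof of Thm. 6.2 (iii) p. 111 for `K̃/K`
Galois: "every monomorphism of `D` is an isomorphism"). [cite: MochizukiFrdI2008, Thm. 6.2 (iii) p.111] -/
theorem not_isIso_toBot (hK : 1 < Module.finrank F K) (β : (⟨⊤⟩ : FinSubextCat F K) ⟶ ⟨⊥⟩) :
    ¬ IsIso β := by
  intro h
  obtain ⟨g, -, -⟩ := h.out
  let ι : (⊤ : IntermediateField F K) →ₐ[F] (⊥ : IntermediateField F K) := g.toAlgHom
  have hle : Module.finrank F (⊤ : IntermediateField F K) ≤ Module.finrank F (⊥ : IntermediateField F K) :=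
    LinearMap.finrank_le_finrank_of_injective (f := ι.toLinearMap) ι.toRingHom.injective
  rw [IntermediateField.finrank_top', IntermediateField.finrank_bot] at hle
  omega

omit [NumberField F] in
/-- Under rigidity of a proper extension `K/F`, the base category `D = FinSubextCat F K` is **not of FSM-type**
(§0 p. 14): `Spec K → Spec F` is an FSM-morphism that is not an isomorphism. (For `K/F` Galois, `D` IS of
FSM-type: abc-iut-L6-t10's `FinSubextCat.isOfFSMType`, [FrdI] proof of Thm. 6.2 (iii) p. 111.)
[cite: MochizukiFrdI2008, Thm. 6.2 (iii) p.111] -/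
theorem not_isOfFSMType_of_subsingleton_algEnd (hEnd : ∀ φ ψ : K →ₐ[F] K, φ = ψ)
    (hK : 1 < Module.finrank F K) : ¬ IsOfFSMType (FinSubextCat F K) := fun h =>
  let β : (⟨⊤⟩ : FinSubextCat F K) ⟶ ⟨⊥⟩ := ⟨IntermediateField.inclusion bot_le⟩
  not_isIso_toBot hK β (h.isIso_of_isFSM β (isFSM_toBot_of_subsingleton_algEnd hEnd β))

/-- Archimedean coordinates of a pulled-back effective arithmetic divisor along `Spec K → Spec F` are COPIED
from the place below (`EffArithDivisor.pullback_snd`). [cite: MochizukiFrdI2008, Ex. 6.3 p.113] -/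
theorem pull_toBot_snd (β : (⟨⊤⟩ : FinSubextCat F K) ⟶ ⟨⊥⟩)
    (x : (arithDivisorFunctor F K).obj (op (⟨⊥⟩ : FinSubextCat F K)))
    (w : InfinitePlace (⊤ : IntermediateField F K)) :
    (Multiplicative.toAdd (pull (arithDivisorFunctor F K) β x)).2 w =
      (Multiplicative.toAdd x).2 (w.comap (β.toAlgHom : (⊥ : IntermediateField F K) →+* (⊤ : IntermediateField F K))) :=
  rfl

/-- If `Spec F` has a single archimedean place while `Spec K` has two distinct ones, the pull-back of effective
arithmetic divisors `Φ(F) → Φ(K)` is NOT surjective: the archimedean indicator of one place of `K` is not a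
pull-back. [cite: MochizukiFrdI2008, Ex. 6.3 p.113] -/
theorem pull_toBot_not_surjective
    (hbot : ∀ v v' : InfinitePlace (⊥ : IntermediateField F K), v = v')
    {w₁ w₂ : InfinitePlace (⊤ : IntermediateField F K)} (hw : w₁ ≠ w₂)
    (β : (⟨⊤⟩ : FinSubextCat F K) ⟶ ⟨⊥⟩) :
    ¬ Function.Surjective (pull (arithDivisorFunctor F K) β) := by
  classical
  intro hsurj
  haveI : NumberField (⊤ : IntermediateField F K) := FinSubextCat.numberField (⟨⊤⟩ : FinSubextCat F K)
  let D : EffArithDivisor (⊤ : IntermediateField F K) := (0, fun w => if w = w₁ then 1 else 0)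
  obtain ⟨x, hx⟩ := hsurj (Multiplicative.ofAdd D)
  have h1 := pull_toBot_snd β x w₁
  have h2 := pull_toBot_snd β x w₂
  rw [hx] at h1 h2
  rw [hbot (w₂.comap _) (w₁.comap _), ← h1] at h2
  simp [D, hw.symm] at h2

/-- **`Φ` is not a monoid on `D`** (Def. 1.1 (ii)) for a rigid `K/F` with a split archimedean place: the
FSM-morphism `Spec K → Spec F` does not pull back to a bijection. [cite: MochizukiFrdI2008, Def. 1.1 (ii) p.19] -/
theorem not_isMonoidOn_of_subsingleton_algEnd (hEnd : ∀ φ ψ : K →ₐ[F] K, φ = ψ)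
    (hbot : ∀ v v' : InfinitePlace (⊥ : IntermediateField F K), v = v')
    {w₁ w₂ : InfinitePlace (⊤ : IntermediateField F K)} (hw : w₁ ≠ w₂) :
    ¬ IsMonoidOn (arithDivisorFunctor F K) := fun h =>
  let β : (⟨⊤⟩ : FinSubextCat F K) ⟶ ⟨⊥⟩ := ⟨IntermediateField.inclusion bot_le⟩
  pull_toBot_not_surjective hbot hw β
    (h.bijective_of_isFSM β (isFSM_toBot_of_subsingleton_algEnd hEnd β)).2

/-- **`Ex63_isFrobenioid F K` fails** for a rigid `K/F` with a split archimedean place: a Frobenioid is in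
particular a pre-Frobenioid, whose divisor monoid is a monoid on the base category.
[cite: MochizukiFrdI2008, Ex. 6.3 p.113] -/
theorem not_ex63_isFrobenioid_of_subsingleton_algEnd (hEnd : ∀ φ ψ : K →ₐ[F] K, φ = ψ)
    (hbot : ∀ v v' : InfinitePlace (⊥ : IntermediateField F K), v = v')
    {w₁ w₂ : InfinitePlace (⊤ : IntermediateField F K)} (hw : w₁ ≠ w₂) :
    ¬ Ex63_isFrobenioid F K := fun h =>
  not_isMonoidOn_of_subsingleton_algEnd hEnd hbot hw h.isPreFrobenioid.isMonoidOn

end General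

/-! ### B. Over `ℚ`: any rigid number field of degree at least `3` -/

section OverRat

variable {K : Type} [Field K] [Algebra ℚ K] [FiniteDimensional ℚ K]

omit [FiniteDimensional ℚ K] in
/-- The bottom field `ℚ ⊆ K` has exactly one archimedean place (`r₁ + 2 r₂ = 1`). [folklore] -/
private theorem infinitePlace_bot_eq (v v' : InfinitePlace (⊥ : IntermediateField ℚ K)) : v = v' := by
  haveI : NumberField (⊥ : IntermediateField ℚ K) := FinSubextCat.numberField (⟨⊥⟩ : FinSubextCat ℚ K)
  have h := InfinitePlace.card_add_two_mul_card_eq_rank (K := (⊥ : IntermediateField ℚ K))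
  have hc := InfinitePlace.card_eq_nrRealPlaces_add_nrComplexPlaces (K := (⊥ : IntermediateField ℚ K))
  have hb := IntermediateField.finrank_bot (F := ℚ) (E := K)
  have h' : InfinitePlace.nrRealPlaces (⊥ : IntermediateField ℚ K) +
      2 * InfinitePlace.nrComplexPlaces (⊥ : IntermediateField ℚ K) = 1 := by
    rw [← hb]
    convert h using 2 <;> first | rfl | exact Subsingleton.elim _ _
  have h1 : Fintype.card (InfinitePlace (⊥ : IntermediateField ℚ K)) ≤ 1 := by omega
  exact (Fintype.card_le_one_iff.mp h1) v v'

/-- A number field of degree `≥ 3` has two distinct archimedean places (`r₁ + 2 r₂ = n` forces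
`r₁ + r₂ ≥ 2`). [folklore] -/
private theorem exists_infinitePlace_top_ne (h3 : 3 ≤ Module.finrank ℚ K) :
    ∃ w₁ w₂ : InfinitePlace (⊤ : IntermediateField ℚ K), w₁ ≠ w₂ := by
  haveI : NumberField (⊤ : IntermediateField ℚ K) := FinSubextCat.numberField (⟨⊤⟩ : FinSubextCat ℚ K)
  have h := InfinitePlace.card_add_two_mul_card_eq_rank (K := (⊤ : IntermediateField ℚ K))
  have hc := InfinitePlace.card_eq_nrRealPlaces_add_nrComplexPlaces (K := (⊤ : IntermediateField ℚ K))
  have ht := IntermediateField.finrank_top' (F := ℚ) (E := K)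
  have h' : InfinitePlace.nrRealPlaces (⊤ : IntermediateField ℚ K) +
      2 * InfinitePlace.nrComplexPlaces (⊤ : IntermediateField ℚ K) = Module.finrank ℚ K := by
    rw [← ht]
    convert h using 2 <;> first | rfl | exact Subsingleton.elim _ _
  have h1 : 1 < Fintype.card (InfinitePlace (⊤ : IntermediateField ℚ K)) := by omega
  exact Fintype.exists_pair_of_one_lt_card h1

/-- **Over `ℚ`**: a number field `K` of degree `≥ 3` whose only `ℚ`-algebra endomorphism is the identity
violates `Ex63_isFrobenioid ℚ K`. [cite: MochizukiFrdI2008, Ex. 6.3 p.113] -/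
theorem not_ex63_isFrobenioid_rat (hEnd : ∀ φ ψ : K →ₐ[ℚ] K, φ = ψ) (h3 : 3 ≤ Module.finrank ℚ K) :
    ¬ Ex63_isFrobenioid ℚ K := by
  obtain ⟨w₁, w₂, hw⟩ := exists_infinitePlace_top_ne (K := K) h3
  exact not_ex63_isFrobenioid_of_subsingleton_algEnd hEnd infinitePlace_bot_eq hw

end OverRat

/-! ### C. The pure cubic field `ℚ(∛2)` -/

section Cubic

/-- `X³ − 2` is monic. [folklore] -/
private theorem cubicPoly_monic : (X ^ 3 - C 2 : ℚ[X]).Monic := monic_X_pow_sub_C _ (by norm_num)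

/-- `deg (X³ − 2) = 3`. [folklore] -/
private theorem cubicPoly_natDegree : (X ^ 3 - C 2 : ℚ[X]).natDegree = 3 := natDegree_X_pow_sub_C

/-- `2` is not the cube of a rational number (rational root theorem + cubes modulo `7`). [folklore] -/
private theorem not_isRoot_cubicPoly (q : ℚ) : ¬ IsRoot (X ^ 3 - C 2 : ℚ[X]) q := by
  intro hq
  have hq3 : q ^ 3 = 2 := by
    have h : q ^ 3 - 2 = 0 := by
      simpa [IsRoot, eval_sub, eval_pow, eval_X, eval_C] using hq
    exact sub_eq_zero.mp h
  -- `q` is an integer by the rational root theorem applied to the monic `X³ − 2 ∈ ℤ[X]`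
  have hmon : (X ^ 3 - C (2 : ℤ) : ℤ[X]).Monic := monic_X_pow_sub_C _ (by norm_num)
  have haev : aeval q (X ^ 3 - C (2 : ℤ) : ℤ[X]) = 0 := by
    rw [map_sub, map_pow, aeval_X, aeval_C, hq3]
    simp
  obtain ⟨n, hn⟩ := isInteger_of_is_root_of_monic hmon haev
  have hn3 : (n : ℚ) ^ 3 = 2 := by
    rw [← hq3, ← hn]
    simp
  have hn3' : n ^ 3 = 2 := by exact_mod_cast hn3
  have h7 : ((n : ZMod 7)) ^ 3 = 2 := by exact_mod_cast congrArg (Int.cast : ℤ → ZMod 7) hn3'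
  exact absurd h7 (by generalize (n : ZMod 7) = x; revert x; decide)

/-- `X³ − 2` is irreducible over `ℚ` (a cubic without rational roots). [folklore] -/
private theorem cubicPoly_irreducible : Irreducible (X ^ 3 - C 2 : ℚ[X]) := by
  refine (cubicPoly_monic.irreducible_iff_roots_eq_zero_of_degree_le_three
    (by rw [cubicPoly_natDegree]; norm_num) (le_of_eq cubicPoly_natDegree)).mpr ?_
  refine Multiset.eq_zero_of_forall_notMem fun q hq => ?_
  exact not_isRoot_cubicPoly q ((mem_roots cubicPoly_monic.ne_zero).mp hq)

/-- `ℚ(∛2) = ℚ[X]/(X³ − 2)` has degree `3`. [folklore] -/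
private theorem cubicField_finrank :
    Module.finrank ℚ (AdjoinRoot (X ^ 3 - C 2 : ℚ[X])) = 3 := by
  rw [(AdjoinRoot.powerBasis cubicPoly_monic.ne_zero).finrank, AdjoinRoot.powerBasis_dim,
    cubicPoly_natDegree]

/-- In `ℚ(∛2)` the class of `X` is a cube root of `2`. [folklore] -/
private theorem cubicField_root_pow :
    (AdjoinRoot.root (X ^ 3 - C 2 : ℚ[X])) ^ 3 = 2 := by
  have h := AdjoinRoot.eval₂_root (X ^ 3 - C 2 : ℚ[X])
  rw [eval₂_sub, eval₂_X_pow, eval₂_C, map_ofNat (AdjoinRoot.of _) 2, sub_eq_zero] at h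
  exact h

/-- **Rigidity of `ℚ(∛2)`**: its only `ℚ`-algebra endomorphism is the identity — an endomorphism moves `∛2` to
a cube root of `2`, and under the real embedding `∛2 ↦ 2^{1/3}` cube roots of `2` are unique since `x ↦ x³`
is injective on `ℝ`. [folklore] -/
private theorem cubicField_algEnd_eq [Fact (Irreducible (X ^ 3 - C 2 : ℚ[X]))]
    (φ ψ : AdjoinRoot (X ^ 3 - C 2 : ℚ[X]) →ₐ[ℚ] AdjoinRoot (X ^ 3 - C 2 : ℚ[X])) : φ = ψ := by
  -- the real embedding
  set r : ℝ := (2 : ℝ) ^ ((3 : ℕ) : ℝ)⁻¹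
  have hr : r ^ 3 = 2 := Real.rpow_inv_natCast_pow (by norm_num) (by norm_num)
  have he : (X ^ 3 - C 2 : ℚ[X]).eval₂ (↑(Algebra.ofId ℚ ℝ) : ℚ →+* ℝ) r = 0 := by
    simp [eval₂_sub, eval₂_X_pow, eval₂_C, hr]
  let e : AdjoinRoot (X ^ 3 - C 2 : ℚ[X]) →ₐ[ℚ] ℝ := AdjoinRoot.liftAlgHom (X ^ 3 - C 2 : ℚ[X]) (Algebra.ofId ℚ ℝ) r he
  have hinj3 : Function.Injective fun a : ℝ => a ^ 3 := (Odd.strictMono_pow (by decide)).injective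
  have hroot : ∀ χ : AdjoinRoot (X ^ 3 - C 2 : ℚ[X]) →ₐ[ℚ] AdjoinRoot (X ^ 3 - C 2 : ℚ[X]),
      χ (AdjoinRoot.root (X ^ 3 - C 2 : ℚ[X])) = AdjoinRoot.root (X ^ 3 - C 2 : ℚ[X]) := by
    intro χ
    apply (e : AdjoinRoot (X ^ 3 - C 2 : ℚ[X]) →+* ℝ).injective
    apply hinj3
    have h1 : (e (χ (AdjoinRoot.root (X ^ 3 - C 2 : ℚ[X])))) ^ 3 = 2 := by
      rw [← map_pow, ← map_pow, cubicField_root_pow, map_ofNat χ 2, map_ofNat e 2]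
    have h2 : (e (AdjoinRoot.root (X ^ 3 - C 2 : ℚ[X]))) ^ 3 = 2 := by
      rw [← map_pow, cubicField_root_pow, map_ofNat e 2]
    change (e (χ (AdjoinRoot.root (X ^ 3 - C 2 : ℚ[X])))) ^ 3 = (e (AdjoinRoot.root (X ^ 3 - C 2 : ℚ[X]))) ^ 3
    rw [h1, h2]
  exact AdjoinRoot.algHom_ext ((hroot φ).trans (hroot ψ).symm)

/-- **`Ex63_isFrobenioid ℚ ℚ(∛2)` is false.** [cite: MochizukiFrdI2008, Ex. 6.3 p.113] -/
theorem not_ex63_isFrobenioid_cubicField [Fact (Irreducible (X ^ 3 - C 2 : ℚ[X]))] :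
    ¬ Ex63_isFrobenioid ℚ (AdjoinRoot (X ^ 3 - C 2 : ℚ[X])) := by
  haveI : Module.Finite ℚ (AdjoinRoot (X ^ 3 - C 2 : ℚ[X])) := cubicPoly_monic.finite_adjoinRoot
  exact not_ex63_isFrobenioid_rat cubicField_algEnd_eq (by rw [cubicField_finrank])

end Cubic

end Ex63NonGalois

/-- **FACT-LIST F-1130, universal closure REFUTED in the kernel**: the typed named fact
`Ex63_isFrobenioid F K` ([FrdI] Ex. 6.3 "this data determines a [model] Frobenioid") over its own binders
`(F) [Field F] [NumberField F] (K) [Field K] [Algebra F K]` — which omit print's hypothesis that `K/F` is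
GALOIS — is false at `F = ℚ`, `K = ℚ(∛2)`: there `Spec K → Spec ℚ` is a non-invertible FSM-morphism of
`D = FinSubextCat ℚ K` along which the arithmetic divisor monoid does not pull back surjectively, so `Φ` is not a
monoid on `D` (Def. 1.1 (ii)) and the model functor is not a pre-Frobenioid. The instance form under
`[IsGalois F K]` is PROVED in the tree (`Ex63_isFrobenioid_holds'`, abc-iut-L6-t10 / FactListWitnessesFrd).
[cite: MochizukiFrdI2008, Ex. 6.3 p.113] -/
theorem not_forall_ex63_isFrobenioid :
    ¬ ∀ (F : Type) [Field F] [NumberField F] (K : Type) [Field K] [Algebra F K],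
      Literature.AlgebraicGeometry.Frobenioids.Ex63_isFrobenioid F K := by
  intro h
  haveI : Fact (Irreducible (X ^ 3 - C 2 : ℚ[X])) := ⟨Ex63NonGalois.cubicPoly_irreducible⟩
  exact Ex63NonGalois.not_ex63_isFrobenioid_cubicField (h ℚ (AdjoinRoot (X ^ 3 - C 2 : ℚ[X])))

end Literature.AlgebraicGeometry.Frobenioids

end
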